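import Summits.PneNP.PneNP.Theorems.OracleRefusal.Negative.StaInvApp

/-!
# `OracleRefusal` (stmt-PneNP-1864) — negative side, II: Semantic inversion, part 5 (§B.7): the CHAIN shape `c₀ b₀ (c₁ b₁ (⋯ x_z))` (`IsChain`), its inversions and preservation
backwards along renamings, presence of the tail and heads in the context (`chain_present`).
-/

namespace Summit.PneNP.PneNP.Theorems.OracleRefusal.Negative

open Literature.Computability.ImplicitComplexity
open Literature.Computability.ImplicitComplexity.URel
open Literature.Computability.ImplicitComplexity.STA (Deriv Ctx Term LinTy SoftTy encWord encBit tyS tyB tyF mpxRen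
  liftRen)

/-! ## §B.7 Chains `c₀ b₀ (c₁ b₁ (⋯ x_z))`: trees over occurrence points, the tail at `z` -/

/-- The chain shape with tail variable `z`, letters `bs` and head variables `hs` (one per letter):
`[] ↦ x_z`, `b :: bs, c :: hs ↦ c b̲ (chain bs hs)`. [cite: GaboardiMarionRonchidellarocca2008, §3.2] -/
inductive IsChain (z : ℕ) : Term → List Bool → List ℕ → Prop
  | nil : IsChain z (.var z) [] []
  | cons {c : ℕ} {b : Bool} {C : Term} {bs : List Bool} {hs : List ℕ} (h : IsChain z C bs hs) :
      IsChain z (.app (.app (.var c) (encBit b)) C) (b :: bs) (c :: hs)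

/-- `chainTo q w` is a chain with tail `0` and all heads `q`. [cite: GaboardiMarionRonchidellarocca2008, §3.2] -/
theorem isChain_chainTo (q : ℕ) : ∀ w : List Bool, IsChain 0 (STA.chainTo q w) w (List.replicate w.length q)
  | [] => IsChain.nil
  | b :: w => by
      rw [List.length_cons, List.replicate_succ]
      exact IsChain.cons (isChain_chainTo q w)

/-- Inversion: a chain on a variable is the tail. [folklore] -/
theorem IsChain.var_inv {z i : ℕ} {bs : List Bool} {hs : List ℕ} (h : IsChain z (.var i) bs hs) :
    i = z ∧ bs = [] ∧ hs = [] := by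
  cases h; exact ⟨rfl, rfl, rfl⟩

/-- Inversion: a chain is never an abstraction. [folklore] -/
theorem IsChain.lam_inv {z : ℕ} {N : Term} {bs : List Bool} {hs : List ℕ} (h : IsChain z (.lam N) bs hs) : False := by
  cases h

/-- Inversion: a chain is never a sum. [folklore] -/
theorem IsChain.sum_inv {z : ℕ} {N N' : Term} {bs : List Bool} {hs : List ℕ} (h : IsChain z (.sum N N') bs hs) :
    False := by
  cases h

/-- Inversion: a chain on an application is a head applied to a letter and a shorter chain (the argument untouched).
[folklore] -/
theorem IsChain.app_inv {z : ℕ} {F N : Term} {bs : List Bool} {hs : List ℕ} (h : IsChain z (.app F N) bs hs) :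
    ∃ c b bs' hs', F = .app (.var c) (encBit b) ∧ bs = b :: bs' ∧ hs = c :: hs' ∧ IsChain z N bs' hs' := by
  cases h with
  | cons h => exact ⟨_, _, _, _, rfl, rfl, rfl, h⟩

/-- Chains are preserved backwards along renamings (the letters are closed). [folklore] -/
theorem IsChain.of_rename {z : ℕ} {C : Term} {bs : List Bool} {hs : List ℕ} (h : IsChain z C bs hs) :
    ∀ {C' : Term} {f : ℕ → ℕ}, C'.rename f = C → ∃ z' hs', IsChain z' C' bs hs' ∧ f z' = z ∧ hs'.map f = hs := by
  induction h with
  | nil =>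
    intro C' f he
    obtain ⟨z', rfl, hz'⟩ := rename_eq_var he
    exact ⟨z', [], IsChain.nil, hz', rfl⟩
  | cons _ ih =>
    intro C' f he
    obtain ⟨F', N', rfl, hF, hN⟩ := rename_eq_app he
    obtain ⟨F'', B', rfl, hF', hB⟩ := rename_eq_app hF
    obtain ⟨c', rfl, hc'⟩ := rename_eq_var hF'
    have hB' := rename_eq_encBit hB
    subst hB'
    obtain ⟨z', hs', hC, hz', hhs⟩ := ih hN
    exact ⟨z', c' :: hs', IsChain.cons hC, hz', by simp [hhs, hc']⟩

/-- A derivation of a chain has the tail variable and every head in its context.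
[cite: GaboardiMarionRonchidellarocca2008, Table 2] -/
theorem chain_present : {d : ℕ} → {Γ : Ctx} → {M : Term} → {σ : SoftTy} → (D : Deriv d Γ M σ) → {z : ℕ} →
    {bs : List Bool} → {hs : List ℕ} → IsChain z M bs hs → (∃ τ, Γ z = some τ) ∧ ∀ c ∈ hs, ∃ τ, Γ c = some τ
  | _, _, _, _, .ax h, z, bs, hs, hC => by
      obtain ⟨rfl, rfl, rfl⟩ := hC.var_inv
      exact ⟨⟨_, h.1⟩, fun c hc => by simp at hc⟩
  | _, _, _, _, .weak j A h hj hΓ', z, bs, hs, hC => by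
      obtain ⟨⟨τ, hτ⟩, hh⟩ := chain_present h hC
      have hzj : z ≠ j := fun e => by rw [e, hj] at hτ; cases hτ
      refine ⟨⟨τ, by rw [hΓ', Function.update_of_ne hzj, hτ]⟩, fun c hc => ?_⟩
      obtain ⟨τ', hτ'⟩ := hh c hc
      have hcj : c ≠ j := fun e => by rw [e, hj] at hτ'; cases hτ'
      exact ⟨τ', by rw [hΓ', Function.update_of_ne hcj, hτ']⟩
  | _, _, _, _, .lam _, _, _, _, hC => hC.lam_inv.elim
  | _, _, _, _, .app (Γ := Γ) hs h₁ h₂, z, bs, hds, hC => by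
      obtain ⟨c, b, bs', hs', rfl, rfl, rfl, hC'⟩ := hC.app_inv
      obtain ⟨⟨τ, hτ⟩, hh⟩ := chain_present h₂ hC'
      obtain ⟨τc, hτc⟩ := app1_present h₁ rfl
      refine ⟨⟨τ, ?_⟩, fun c' hc' => ?_⟩
      · rcases hs z with ⟨-, h2⟩ | ⟨-, h2⟩
        · rw [h2] at hτ; cases hτ
        · exact h2 ▸ hτ
      · rcases List.mem_cons.1 hc' with rfl | hc'
        · rcases hs c' with ⟨h1, -⟩ | ⟨h1, -⟩
          · exact ⟨τc, h1 ▸ hτc⟩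
          · rw [h1] at hτc; cases hτc
        · obtain ⟨τ', hτ'⟩ := hh c' hc'
          rcases hs c' with ⟨-, h2⟩ | ⟨-, h2⟩
          · rw [h2] at hτ'; cases hτ'
          · exact ⟨τ', h2 ▸ hτ'⟩
  | _, _, _, _, .mpx (Γ := Γ) (σ := τ₀) S j h hS hj hΓ' hM', z, bs, hs, hC => by
      rw [hM'] at hC
      obtain ⟨z₀, hs₀, hC₀, hz₀, hhs⟩ := hC.of_rename rfl
      obtain ⟨⟨τ, hτ⟩, hh⟩ := chain_present h hC₀
      have hjS : j ∉ S := fun hj' => by simpa [hj] using hS j hj'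
      have pres : ∀ s τ, Γ s = some τ → ∃ τ', (Γ.mpx S j τ₀) (mpxRen S j s) = some τ' := by
        intro s τ hsτ
        have hsj : s ≠ j := fun e => by rw [e, hj] at hsτ; cases hsτ
        by_cases hsS : s ∈ S
        · exact ⟨τ₀.bang, by simp [mpxRen, hsS, Ctx.mpx, hjS]⟩
        · exact ⟨τ, by simp [mpxRen, hsS, Ctx.mpx, hsj, hsτ]⟩
      subst hΓ'
      refine ⟨hz₀ ▸ pres z₀ τ hτ, fun c hc => ?_⟩
      rw [← hhs] at hc
      obtain ⟨c₀, hc₀, rfl⟩ := List.mem_map.1 hc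
      obtain ⟨τ', hτ'⟩ := hh c₀ hc₀
      exact pres c₀ τ' hτ'
  | _, _, _, _, .sp h hΓ', z, bs, hs, hC => by
      obtain ⟨⟨τ, hτ⟩, hh⟩ := chain_present h hC
      subst hΓ'
      refine ⟨⟨τ.bang, by simp [Ctx.bang, hτ]⟩, fun c hc => ?_⟩
      obtain ⟨τ', hτ'⟩ := hh c hc
      exact ⟨τ'.bang, by simp [Ctx.bang, hτ']⟩
  | _, _, _, _, .allI (Γ := Γ) h hΔ, z, bs, hs, hC => by
      obtain ⟨⟨τ, hτ⟩, hh⟩ := chain_present h hC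
      rw [hΔ] at hτ hh
      simp only [Ctx.shift, Option.map_eq_some_iff] at hτ
      obtain ⟨τ', hτ', -⟩ := hτ
      refine ⟨⟨τ', hτ'⟩, fun c hc => ?_⟩
      obtain ⟨τ'', hτ''⟩ := hh c hc
      simp only [Ctx.shift, Option.map_eq_some_iff] at hτ''
      obtain ⟨τ₃, hτ₃, -⟩ := hτ''
      exact ⟨τ₃, hτ₃⟩
  | _, _, _, _, .allE _ h, _, _, _, hC => chain_present h hC
  | _, _, _, _, .sum _ _, _, _, _, hC => hC.sum_inv.elim

end Summit.PneNP.PneNP.Theorems.OracleRefusal.Negative
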